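import Summits.Ventures.CertifiedManyBodySolver.Downfold.TppSeam
import Literature.MathematicalPhysics.QuantumLattice.HubbardHoppingBondNormSharp
import Literature.MathematicalPhysics.QuantumLattice.HubbardTTPrimeKinematicRowsAllFillings
import HarnessLib

/-!
# The object-M energy word of the `t''` seam with the halved constant `C = 4`

Venture CertifiedManyBodySolver, cell `pub/hubbard-downfold` (stage S1), seat hubbard-downfold-mod-1;
namespace `Summit.Ventures.CertifiedManyBodySolver.Downfold`. Companion of `TppSeam.lean`
(`holdsOn_inflate_of_lipschitz` = the (T1) rule «E-word ⊕ C·max|tpp/t| ⇒ M-word», generic in `C`;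
`holdsOn_tiGroundEnergyDensity_objectM` = the instance `C = 8`) and of
`Literature/…/HubbardHoppingBondNormSharp` (Koma–Tasaki's sharp bond norm `‖c†c + h.c.‖ ≤ 1` ⇒
`abs_tiGroundEnergyDensity_tpp_sub_le_four_mul`, constant `4`). Everything here is PROVED. HONEST
FRAMING: still the operator-norm route (`4 · max|tpp/t| ≈ 0.36–0.72` in units of `t` for the cuprate /
nickelate boxes of record); the kinematic constant `16/π²` is not claimed; energy words only.
-/

namespace Summit.Ventures.CertifiedManyBodySolver.Downfold

open NonemptyInterval Literature.MathematicalPhysics.QuantumLattice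

/-- **«e₀ (object M, one-body truncation inflated)» with `C = 4`.** Let `B` carry entries `eS, eSS, eU`
for `tp/t`, `tpp/t`, `U/t`, and let S2 certify `L ≤ e₀(H(1, s, u)) ≤ R` for the translation-invariant
ground-state energy density (range parameter `2`) of the `t–t'` interaction on the cell `eS.encl × eU.encl`.
Then the `t–t'–t''` interaction `H(1, s, s'', u)` has `L − 4m ≤ e₀ ≤ R + 4m` on the box,
`m = max |eSS.lo| |eSS.hi|`. [folklore] -/
theorem holdsOn_tiGroundEnergyDensity_objectM_four {B : OneBandBox} {eS eSS eU : Entry}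
    (hS : B .tpOverT = some eS) (hSS : B .tppOverT = some eSS) (hU : B .UOverT = some eU) {L R : ℝ}
    (hE : ∀ s u : ℝ, s ∈ eS.encl.ratCast ℝ → u ∈ eU.encl.ratCast ℝ →
      L ≤ (hubbardTTPrimeFermionInteraction 1 s u).tiGroundEnergyDensity 2 ∧
        (hubbardTTPrimeFermionInteraction 1 s u).tiGroundEnergyDensity 2 ≤ R) :
    HoldsOn (fun p : OneBandCoord → ℝ =>
      L - 4 * ((max |eSS.encl.fst| |eSS.encl.snd| : ℚ) : ℝ) ≤
          (hubbardTT'T''FermionInteraction 1 (p .tpOverT) (p .tppOverT) (p .UOverT)).tiGroundEnergyDensity 2 ∧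
        (hubbardTT'T''FermionInteraction 1 (p .tpOverT) (p .tppOverT) (p .UOverT)).tiGroundEnergyDensity 2 ≤
          R + 4 * ((max |eSS.encl.fst| |eSS.encl.snd| : ℚ) : ℝ)) B := by
  refine holdsOn_inflate_of_lipschitz hSS
    (f := fun p s'' => (hubbardTT'T''FermionInteraction 1 (p .tpOverT) s'' (p .UOverT)).tiGroundEnergyDensity 2)
    (by norm_num) (fun p s'' => ?_) ?_
  · have h := abs_tiGroundEnergyDensity_tpp_sub_le_four_mul 1 (p .tpOverT) s'' (p .UOverT) 0
    rwa [sub_zero] at h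
  · refine holdsOn_oneBand_of_cell₂ hS hU (W₁ := fun s u =>
      L ≤ (hubbardTT'T''FermionInteraction 1 s 0 u).tiGroundEnergyDensity 2 ∧
        (hubbardTT'T''FermionInteraction 1 s 0 u).tiGroundEnergyDensity 2 ≤ R) fun s u hs hu => ?_
    rw [hubbardTT'T''FermionInteraction_zero]
    exact hE s u hs hu

/-- **The M-window is at most `8·m` wider than the E-window** (bookkeeping for the phase-map annex: the
total inflation of the two-sided energy word across the one-body truncation is `2 · 4 · max|tpp/t|`).
[folklore] -/
theorem objectM_window_width (L R : ℝ) (eSS : Entry) :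
    (R + 4 * ((max |eSS.encl.fst| |eSS.encl.snd| : ℚ) : ℝ)) - (L - 4 * ((max |eSS.encl.fst| |eSS.encl.snd| : ℚ) : ℝ)) =
      (R - L) + 8 * ((max |eSS.encl.fst| |eSS.encl.snd| : ℚ) : ℝ) := by
  ring

/-! ### Appendix (2026-08-27, append-only): the kinematic constant `16/π²` at `μ = 0`

hubbard-box-p1's `HubbardTTPrimeKinematicRowsAllFillings.lean` (p476562) gives the UNCONSTRAINED twin
`abs_tiGroundEnergyDensity_tpp_sub_le_kinematic : |e₀(t,t',t'',U) − e₀(t,t',s'',U)| ≤ (16/π²)|t'' − s''|`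
(every translation-invariant state, any filling, via the doubling pull-back). The object-M energy word of
`TppSeam.lean`'s `μ = 0` object therefore also reads «E ⊕ (16/π²)·m» (the fixed-filling version, the one the
words of record use, is `TppSeamFilling.holdsOn_tiGroundEnergyDensityAt_objectM_kinematic`). -/

/-- **«e₀ (object M, one-body truncation inflated)» with the kinematic constant `16/π²`** (the `μ = 0`
translation-invariant density): an S2 window `L ≤ e₀(H(1, s, u)) ≤ R` on the cell `eS.encl × eU.encl`
becomes `L − (16/π²)m ≤ e₀(H(1, s, s'', u)) ≤ R + (16/π²)m` on the box, `m = max |eSS.lo| |eSS.hi|`.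
[cite: LiebLoss1993, §8, Theorem 8.2] -/
theorem holdsOn_tiGroundEnergyDensity_objectM_kinematic {B : OneBandBox} {eS eSS eU : Entry}
    (hS : B .tpOverT = some eS) (hSS : B .tppOverT = some eSS) (hU : B .UOverT = some eU) {L R : ℝ}
    (hE : ∀ s u : ℝ, s ∈ eS.encl.ratCast ℝ → u ∈ eU.encl.ratCast ℝ →
      L ≤ (hubbardTTPrimeFermionInteraction 1 s u).tiGroundEnergyDensity 2 ∧
        (hubbardTTPrimeFermionInteraction 1 s u).tiGroundEnergyDensity 2 ≤ R) :
    HoldsOn (fun p : OneBandCoord → ℝ =>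
      L - 16 / Real.pi ^ 2 * ((max |eSS.encl.fst| |eSS.encl.snd| : ℚ) : ℝ) ≤
          (hubbardTT'T''FermionInteraction 1 (p .tpOverT) (p .tppOverT) (p .UOverT)).tiGroundEnergyDensity 2 ∧
        (hubbardTT'T''FermionInteraction 1 (p .tpOverT) (p .tppOverT) (p .UOverT)).tiGroundEnergyDensity 2 ≤
          R + 16 / Real.pi ^ 2 * ((max |eSS.encl.fst| |eSS.encl.snd| : ℚ) : ℝ)) B := by
  refine holdsOn_inflate_of_lipschitz hSS
    (f := fun p s'' => (hubbardTT'T''FermionInteraction 1 (p .tpOverT) s'' (p .UOverT)).tiGroundEnergyDensity 2)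
    (by positivity) (fun p s'' => ?_) ?_
  · have h := abs_tiGroundEnergyDensity_tpp_sub_le_kinematic 1 (p .tpOverT) (p .UOverT) s'' 0
    rwa [sub_zero] at h
  · refine holdsOn_oneBand_of_cell₂ hS hU (W₁ := fun s u =>
      L ≤ (hubbardTT'T''FermionInteraction 1 s 0 u).tiGroundEnergyDensity 2 ∧
        (hubbardTT'T''FermionInteraction 1 s 0 u).tiGroundEnergyDensity 2 ≤ R) fun s u hs hu => ?_
    rw [hubbardTT'T''FermionInteraction_zero]
    exact hE s u hs hu

end Summit.Ventures.CertifiedManyBodySolver.Downfold
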